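import Summits.CriticalPhenomena.SAWScalingLimit.Theorems.SAWTotalPositivityBoundaryTP2Defs
import Summits.CriticalPhenomena.SAWScalingLimit.Theorems.SAWTotalPositivityBoundaryTP2Kernel
import Summits.CriticalPhenomena.SAWScalingLimit.Theorems.SAWTotalPositivityBoundaryTP2Symmetry
import Summits.CriticalPhenomena.SAWScalingLimit.Theorems.SAWTotalPositivityBoundaryTP2FirstStep
import Summits.CriticalPhenomena.SAWScalingLimit.Theorems.SAWTotalPositivityBoundaryTP2Avoid
import Summits.CriticalPhenomena.SAWScalingLimit.Theorems.SAWTotalPositivityBoundaryTP2SquareGadget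
import Summits.CriticalPhenomena.SAWScalingLimit.Theorems.EdgeOfPositivity.Negative.EdgeOfPositivityRectDomain
import HarnessLib

/-!
# Crux `BoundaryTP2` (stmt-CriticalPhenomena-7115), line `Sketch`: exact corner kernels of the ladders

Tool stub `stub_ladderKernels` of the line's skeleton: on the ladder
`R_L = discreteDomainGraph (rectDomain L 1) 1` (sites `{0..L} × {0,1}`, lattice adjacency) the
fugacity-`x` self-avoiding path kernel between the corners `(0,r)` and `(L,s)` (`r, s ∈ {0,1}`) is

  `K_L(r,s) = x^L ((1+x)^{L+1} + ε (1-x)^{L+1}) / 2`,   `ε = +1` if `r = s`, `ε = -1` if `r ≠ s`,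

for every `L : ℕ` and every `x ≥ 0`.

Proof: the last-column recursion `K_{L+1}(r,s) = x K_L(r,s) + x² K_L(r,1-s)` with `K_0(r,r) = 1`,
`K_0(r,1-r) = x`. Reverse the paths so that they start at the corner `c = (L+1,s)` of `R_{L+1}`; its
neighbours are `(L,s)` and `c' = (L+1,1-s)` (first step at a vertex of degree two,
`pathKernel_firstStep_pair`). In `R_{L+1} - c` the vertex `c'` is a leaf hanging off `(L,1-s)`: paths
from `(L,s)` to `(0,r)` never visit it (`pathKernel_eq_deleteVert_of_leaf`), paths from `c'` start with
the edge to `(L,1-s)` (`pathKernel_firstStep_single`), and `(R_{L+1} - c) - c' = R_L` as simple graphs on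
`Site 2`. The closed form then follows by induction on `L` (real algebra inside `ENNReal.ofReal` of
manifestly nonnegative quantities: `|1-x|^{n} ≤ (1+x)^{n}` for `x ≥ 0`).
-/

noncomputable section

namespace Summit.CriticalPhenomena.SAWScalingLimit.Theorems.BoundaryTP2

open Literature.Probability.LatticeModels Literature.Probability.RandomPlanarGeometry
open Summit.CriticalPhenomena.SAWScalingLimit.Theorems.EdgeOfPositivity.Negative
open scoped ENNReal

/-! ## Coordinates on the ladder -/

/-- Adjacency in `ℤ²` in coordinates: the sites agree in one coordinate and differ by `1` in the
other (after `Literature…SAWTiles.adj_iff_coord`, restated to keep the imports of this file).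
[folklore] -/
private theorem ladder_zd_adj_iff (u v : Site 2) :
    (zdGraph 2).Adj u v ↔
      ((v 0 = u 0 + 1 ∨ u 0 = v 0 + 1) ∧ v 1 = u 1) ∨
        ((v 1 = u 1 + 1 ∨ u 1 = v 1 + 1) ∧ v 0 = u 0) := by
  rw [zdGraph_adj_iff, Fin.exists_fin_two]
  simp only [funext_iff, Fin.forall_fin_two, Pi.add_apply, Pi.single_eq_same,
    Pi.single_eq_of_ne (one_ne_zero : (1 : Fin 2) ≠ 0),
    Pi.single_eq_of_ne (zero_ne_one : (0 : Fin 2) ≠ 1), add_zero]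
  omega

/-- A site equals `st a b` iff its two coordinates are `a` and `b`. [folklore] -/
private theorem ladder_eq_st_iff (v : Site 2) (a b : ℤ) : v = st a b ↔ v 0 = a ∧ v 1 = b := by
  constructor
  · rintro rfl
    exact ⟨rfl, rfl⟩
  · rintro ⟨h0, h1⟩
    rw [← st_eta v, h0, h1]

/-- Adjacency of the ladder `{0..a} × {0,1}` in coordinates. [folklore] -/
private theorem ladder_adj_iff (a : ℕ) (u v : Site 2) :
    (discreteDomainGraph (rectDomain a 1) 1).Adj u v ↔
      (((v 0 = u 0 + 1 ∨ u 0 = v 0 + 1) ∧ v 1 = u 1) ∨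
          ((v 1 = u 1 + 1 ∨ u 1 = v 1 + 1) ∧ v 0 = u 0)) ∧
        ((0 ≤ u 0 ∧ u 0 ≤ a) ∧ (0 ≤ u 1 ∧ u 1 ≤ 1)) ∧
          ((0 ≤ v 0 ∧ v 0 ≤ a) ∧ (0 ≤ v 1 ∧ v 1 ≤ 1)) := by
  rw [adj_rect_iff, ladder_zd_adj_iff, mem_rectSites_iff, mem_rectSites_iff, Nat.cast_one]

/-! ## The graph-theoretic input of the last-column recursion -/

/-- In `R_0` (the single edge `(0,0) ∼ (0,1)`) the only neighbour of `(0,r)` is `(0,1-r)`. [folklore] -/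
private theorem ladder_base_neighborSet (r : ℤ) (hr : r = 0 ∨ r = 1) :
    (discreteDomainGraph (rectDomain 0 1) 1).neighborSet (st 0 r) = {st 0 (1 - r)} := by
  ext v
  rw [SimpleGraph.mem_neighborSet, ladder_adj_iff, Set.mem_singleton_iff, ladder_eq_st_iff]
  simp only [st_zero, st_one, Nat.cast_zero]
  omega

/-- In `R_{L+1}` the corner `c = (L+1,s)` has exactly the two neighbours `(L,s)` and `(L+1,1-s)`.
[folklore] -/
private theorem ladder_corner_neighborSet (L : ℕ) (s : ℤ) (hs : s = 0 ∨ s = 1) :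
    (discreteDomainGraph (rectDomain (L + 1) 1) 1).neighborSet (st (L + 1 : ℕ) s) =
      {st L s, st (L + 1 : ℕ) (1 - s)} := by
  ext v
  rw [SimpleGraph.mem_neighborSet, ladder_adj_iff, Set.mem_insert_iff, Set.mem_singleton_iff,
    ladder_eq_st_iff, ladder_eq_st_iff]
  simp only [st_zero, st_one]
  push_cast
  omega

/-- In `R_{L+1} - c` (`c = (L+1,s)`) the other site `c' = (L+1,1-s)` of the last column is a leaf: its
only neighbour is `(L,1-s)`. [folklore] -/
private theorem ladder_hanging_neighborSet (L : ℕ) (s : ℤ) (hs : s = 0 ∨ s = 1) :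
    ((discreteDomainGraph (rectDomain (L + 1) 1) 1).deleteEdges
        ((discreteDomainGraph (rectDomain (L + 1) 1) 1).incidenceSet (st (L + 1 : ℕ) s))).neighborSet
        (st (L + 1 : ℕ) (1 - s)) = {st L (1 - s)} := by
  ext v
  rw [SimpleGraph.mem_neighborSet, deleteEdges_incidenceSet_adj, ladder_adj_iff,
    Set.mem_singleton_iff, Ne, Ne, ladder_eq_st_iff, ladder_eq_st_iff, ladder_eq_st_iff]
  simp only [st_zero, st_one]
  push_cast
  omega

/-- Deleting both sites of the last column of `R_{L+1}` leaves `R_L`: `(R_{L+1} - c) - c' = R_L` as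
simple graphs on `Site 2`. [folklore] -/
private theorem ladder_delete_lastColumn (L : ℕ) (s : ℤ) (hs : s = 0 ∨ s = 1) :
    ((discreteDomainGraph (rectDomain (L + 1) 1) 1).deleteEdges
        ((discreteDomainGraph (rectDomain (L + 1) 1) 1).incidenceSet (st (L + 1 : ℕ) s))).deleteEdges
      (((discreteDomainGraph (rectDomain (L + 1) 1) 1).deleteEdges
        ((discreteDomainGraph (rectDomain (L + 1) 1) 1).incidenceSet (st (L + 1 : ℕ) s))).incidenceSet
          (st (L + 1 : ℕ) (1 - s))) =
      discreteDomainGraph (rectDomain L 1) 1 := by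
  ext u v
  rw [deleteEdges_incidenceSet_adj, deleteEdges_incidenceSet_adj, adj_rect_iff, adj_rect_iff]
  constructor
  · rintro ⟨⟨⟨hzd, hu, hv⟩, huc, hvc⟩, huc', hvc'⟩
    rw [mem_rectSites_iff] at hu hv
    rw [Ne, ladder_eq_st_iff] at huc hvc huc' hvc'
    push_cast at hu hv huc hvc huc' hvc'
    refine ⟨hzd, ?_, ?_⟩
    · rw [mem_rectSites_iff]; push_cast; omega
    · rw [mem_rectSites_iff]; push_cast; omega
  · rintro ⟨hzd, hu, hv⟩
    rw [mem_rectSites_iff] at hu hv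
    push_cast at hu hv
    refine ⟨⟨⟨hzd, ?_, ?_⟩, ?_, ?_⟩, ?_, ?_⟩
    · rw [mem_rectSites_iff]; push_cast; omega
    · rw [mem_rectSites_iff]; push_cast; omega
    · rw [Ne, ladder_eq_st_iff]; push_cast; omega
    · rw [Ne, ladder_eq_st_iff]; push_cast; omega
    · rw [Ne, ladder_eq_st_iff]; push_cast; omega
    · rw [Ne, ladder_eq_st_iff]; push_cast; omega

/-! ## The last-column recursion and the closed form -/

/-- **Last-column recursion** `K_{L+1}(r,s) = x K_L(r,s) + x² K_L(r,1-s)` for the corner kernels of the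
ladders (`x ≥ 0`, `s ∈ {0,1}`). [folklore] -/
private theorem ladder_rec (L : ℕ) {x : ℝ} (hx : 0 ≤ x) (r s : ℤ) (hs : s = 0 ∨ s = 1) :
    pathKernel (discreteDomainGraph (rectDomain (L + 1) 1) 1) x (st 0 r) (st (L + 1 : ℕ) s) =
      ENNReal.ofReal x *
        (pathKernel (discreteDomainGraph (rectDomain L 1) 1) x (st 0 r) (st L s) +
          ENNReal.ofReal x *
            pathKernel (discreteDomainGraph (rectDomain L 1) 1) x (st 0 r) (st L (1 - s))) := by
  classical
  set R := discreteDomainGraph (rectDomain (L + 1) 1) 1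
  -- distinctness of the sites involved (columns `0`, `L`, `L + 1`; rows `s ≠ 1 - s`)
  have hca : st (L + 1 : ℕ) s ≠ st 0 r := by
    rw [Ne, ladder_eq_st_iff, st_zero]; push_cast; omega
  have hvv : st (L : ℤ) s ≠ st (L + 1 : ℕ) (1 - s) := by
    rw [Ne, ladder_eq_st_iff, st_zero]; push_cast; omega
  have hc'a : st (L + 1 : ℕ) (1 - s) ≠ st 0 r := by
    rw [Ne, ladder_eq_st_iff, st_zero]; push_cast; omega
  -- first step at the corner `c = (L+1, s)`
  have hN : R.neighborSet (st (L + 1 : ℕ) s) = {st L s, st (L + 1 : ℕ) (1 - s)} :=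
    ladder_corner_neighborSet L s hs
  rw [pathKernel_comm R x (st 0 r) (st (L + 1 : ℕ) s), pathKernel_firstStep_pair R x hx hca hvv hN]
  set R' := R.deleteEdges (R.incidenceSet (st (L + 1 : ℕ) s))
  have hN' : R'.neighborSet (st (L + 1 : ℕ) (1 - s)) = {st L (1 - s)} :=
    ladder_hanging_neighborSet L s hs
  have hleaf : ∀ z, R'.Adj (st (L + 1 : ℕ) (1 - s)) z → z = st L (1 - s) := fun z hz => by
    have hz' : z ∈ R'.neighborSet (st (L + 1 : ℕ) (1 - s)) := hz
    rwa [hN', Set.mem_singleton_iff] at hz'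
  have hRL : R'.deleteEdges (R'.incidenceSet (st (L + 1 : ℕ) (1 - s))) =
      discreteDomainGraph (rectDomain L 1) 1 :=
    ladder_delete_lastColumn L s hs
  rw [pathKernel_eq_deleteVert_of_leaf R' x hleaf hvv hc'a.symm, hRL,
    pathKernel_firstStep_single R' x hx hc'a hN', hRL,
    pathKernel_comm _ x (st (L : ℤ) s) (st 0 r), pathKernel_comm _ x (st (L : ℤ) (1 - s)) (st 0 r)]

/-- For `x ≥ 0`, `|(1 - x)^n| ≤ (1 + x)^n`. [folklore] -/
private theorem ladder_abs_one_sub_pow_le {x : ℝ} (hx : 0 ≤ x) (n : ℕ) :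
    |(1 - x) ^ n| ≤ (1 + x) ^ n := by
  rw [abs_pow]
  exact pow_le_pow_left₀ (abs_nonneg _) (abs_le.2 ⟨by linarith, by linarith⟩) n

/-- The closed forms `x^L ((1+x)^{L+1} ± (1-x)^{L+1}) / 2` are nonnegative for `x ≥ 0`. [folklore] -/
private theorem ladder_closedForm_nonneg {x : ℝ} (hx : 0 ≤ x) (L : ℕ) {ε : ℝ}
    (hε : ε = 1 ∨ ε = -1) :
    0 ≤ x ^ L * ((1 + x) ^ (L + 1) + ε * (1 - x) ^ (L + 1)) / 2 := by
  have h := abs_le.1 (ladder_abs_one_sub_pow_le hx (L + 1))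
  have h2 : 0 ≤ (1 + x) ^ (L + 1) + ε * (1 - x) ^ (L + 1) := by
    rcases hε with rfl | rfl <;> linarith [h.1, h.2]
  exact div_nonneg (mul_nonneg (pow_nonneg hx L) h2) zero_le_two

/-- **Tool stub `stub_ladderKernels`.** Exact corner-to-corner kernels of the ladder `{0..L}×{0,1}`
for every `L` and every `x ≥ 0`: from `(0,r)` to `(L,s)` the self-avoiding paths have total weight
`x^L ((1+x)^{L+1} + (1-x)^{L+1}) / 2` if `r = s` and `x^L ((1+x)^{L+1} - (1-x)^{L+1}) / 2` if `r ≠ s`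
(last-column recursion `K_{L+1}(r,s) = x K_L(r,s) + x² K_L(r,1-s)`, `K_0(r,s) = 1` or `x`).
[folklore] -/
theorem stub_ladderKernels (L : ℕ) {x : ℝ} (hx : 0 ≤ x) (r s : ℤ) (hr : r = 0 ∨ r = 1)
    (hs : s = 0 ∨ s = 1) :
    pathKernel (discreteDomainGraph (rectDomain L 1) 1) x (st 0 r) (st L s) =
      ENNReal.ofReal (x ^ L * ((1 + x) ^ (L + 1) + (if r = s then 1 else -1) * (1 - x) ^ (L + 1)) / 2) := by
  induction L generalizing s with
  | zero =>
    rcases eq_or_ne r s with rfl | hne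
    · rw [Nat.cast_zero, pathKernel_self, if_pos rfl,
        show x ^ 0 * ((1 + x) ^ (0 + 1) + 1 * (1 - x) ^ (0 + 1)) / 2 = 1 by ring, ENNReal.ofReal_one]
    · obtain rfl : s = 1 - r := by omega
      have hab : st 0 r ≠ st 0 (1 - r) := by
        rw [Ne, ladder_eq_st_iff, st_zero, st_one]; omega
      rw [if_neg hne, Nat.cast_zero,
        pathKernel_firstStep_single _ x hx hab (ladder_base_neighborSet r hr), pathKernel_self, mul_one,
        show x ^ 0 * ((1 + x) ^ (0 + 1) + (-1) * (1 - x) ^ (0 + 1)) / 2 = x by ring]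
  | succ L ih =>
    rw [ladder_rec L hx r s hs, ih s hs, ih (1 - s) (by omega)]
    have hA := ladder_closedForm_nonneg hx L (ite_eq_or_eq (P := r = s) (1 : ℝ) (-1))
    have hB := ladder_closedForm_nonneg hx L (ite_eq_or_eq (P := r = 1 - s) (1 : ℝ) (-1))
    rw [← ENNReal.ofReal_mul hx, ← ENNReal.ofReal_add hA (mul_nonneg hx hB), ← ENNReal.ofReal_mul hx]
    congr 1
    have hε : (if r = 1 - s then (1 : ℝ) else -1) = -(if r = s then (1 : ℝ) else -1) := by
      rcases hr with rfl | rfl <;> rcases hs with rfl | rfl <;> norm_num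
    rw [hε]
    ring

end Summit.CriticalPhenomena.SAWScalingLimit.Theorems.BoundaryTP2
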